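import Literature.NumberTheory.LFunctions.Zhang2022.Section8ProfileSjTerms
import HarnessLib

/-!
# Zhang (2022) §8 for profile data, BILINEAR version: the margins of the two MIXED slivers (`θ_u ≠ θ_v`) — each
# `≤ K·𝓛⁻¹` after the normalisation `×Λ/π` — and the gap scale `τ₁ ≤ |θ_u − θ_v|` at a large modulus

Topic `Literature/NumberTheory/LFunctions/Zhang2022` (Landau–Siegel audit tree; verdict-neutral). Y. Zhang, *Discrete mean
estimates and the Landau–Siegel zero*, arXiv:2211.02515v1 (2022) [Zhang2022LandauSiegel] — **an unrefereed manuscript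
under adjudication; nothing here asserts or denies its Theorems 1–2; no claim about Landau–Siegel zeros.** Cell
landau-siegel §D, crux K0 = stmt-Parity-20459 `InClassSideTablesPiece` (line «sjrows»), prover ls-knife-K0-p1 g3.
Pure real-inequality bookkeeping for the bilinear row (S) of two `C²` short pieces of lengths `θ_u ≠ θ_v`
(`Section8ProfilePairRanges.sliver_term_pair_psiCrude` / `_antiCrude`), companion of `Section8ProfileSjBounds.sliverTotal_le`
(the equal-length sliver):

* `sliverPairB_total_le` (`θ_u < θ_v`): `(Λ/π)·2e⁴³⁰·[B₁τ₁(1+τ₁Λ)·Λ⁻¹(L′K₀ + δN₀)]·(1 + 2L₁) ≤ (36e⁴³⁰/π)B₁(4e^{9/2}K + K_N)·𝓛⁻¹`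
  (`L₁³ ≤ 𝓛⁴`, `L′ ≤ 4e^{9/2}𝓛²`, `δN₀ ≤ K_N𝓛⁻³`);
* `sliverPairC_total_le` (`θ_v < θ_u`): `(Λ/π)·2e⁴³⁰·[Λ⁻¹(L′J₀ + δM₀)·B₁τ₁Ξ₀(1+2L₁)³]·(1 + 2L₁) ≤ (324e⁴³⁰/π)B₁Ξ₀(4e^{9/2}J + K_M)·𝓛⁻¹`
  (`L₁⁵ ≤ 𝓛⁶`, `δM₀ ≤ K_M𝓛⁻⁵`);
* `gap_scales` — `𝓛 ≥ max(1, 2/g)` gives `2L₁/Λ ≤ g` and `L₁/Λ ≤ g` (the shorter piece's sliver lies in the longer piece's good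
  range once `τ₁ ≤ |θ_u − θ_v|`).

## References
* Y. Zhang, arXiv:2211.02515v1 (2022), §8 Lemmas 8.2–8.4, display before (8.10), p.47. [cite: Zhang2022LandauSiegel, §8 p.47]
-/

noncomputable section

open Real

namespace Literature.NumberTheory.LFunctions.Zhang2022.DipoleRule

/-- `log(e^{θΛ}/e^{(θ−τ₁)Λ}) = 2L₁` (`τ₁ = 2L₁/Λ`, `Λ = ℓ⁹ ≠ 0`). [cite: Zhang2022LandauSiegel, §8 p.47] -/
theorem log_sliver_ratio {ℓ θ : ℝ} (hℓ : 0 < ℓ) :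
    Real.log (Real.exp (θ * ℓ ^ 9) / Real.exp ((θ - 2 * ℓ ^ (11 / 10 : ℝ) / ℓ ^ 9) * ℓ ^ 9))
      = 2 * ℓ ^ (11 / 10 : ℝ) := by
  have h9 : (ℓ ^ 9) ≠ 0 := by positivity
  rw [Real.log_div (Real.exp_pos _).ne' (Real.exp_pos _).ne', Real.log_exp, Real.log_exp]
  field_simp
  ring

/-- **Mixed sliver, `θ_u < θ_v`, total `≤ K·𝓛⁻¹` after `×Λ/π`:** if
`N ≤ 2e⁴³⁰·[(B₁τ₁(1+τ₁Λ))·(Λ⁻¹(L′K₀ + dN))]·(1 + log(e^{θΛ}/e^{(θ−τ₁)Λ}))` with `0 ≤ K₀ ≤ K`, `0 ≤ dN ≤ K_N/ℓ³`,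
`0 ≤ L′ ≤ 4e^{9/2}ℓ²`, `B₁ ≥ 0`, `ℓ ≥ 3`, then `(ℓ⁹/π)·N ≤ (36e⁴³⁰/π)·B₁·(4e^{9/2}K + K_N)/ℓ`.
[cite: Zhang2022LandauSiegel, §8 Lemmas 8.3–8.4, p.47] -/
theorem sliverPairB_total_le {ℓ θ B₁ K₀ K dN KN L' N : ℝ} (hℓ : 3 ≤ ℓ) (hB1 : 0 ≤ B₁) (hK00 : 0 ≤ K₀) (hK : K₀ ≤ K)
    (hdN0 : 0 ≤ dN) (hdN : dN ≤ KN / ℓ ^ 3) (hL'0 : 0 ≤ L') (hL' : L' ≤ 4 * Real.exp (9 / 2) * ℓ ^ 2)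
    (hN : N ≤ 2 * Real.exp 430 *
        ((B₁ * (2 * ℓ ^ (11 / 10 : ℝ) / ℓ ^ 9) * (1 + 2 * ℓ ^ (11 / 10 : ℝ) / ℓ ^ 9 * ℓ ^ 9))
          * ((ℓ ^ 9)⁻¹ * (L' * K₀ + dN)))
        * (1 + Real.log (Real.exp (θ * ℓ ^ 9) / Real.exp ((θ - 2 * ℓ ^ (11 / 10 : ℝ) / ℓ ^ 9) * ℓ ^ 9)))) :
    ℓ ^ 9 / π * N ≤ 36 * Real.exp 430 / π * B₁ * (4 * Real.exp (9 / 2) * K + KN) / ℓ := by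
  have hℓ1 : 1 ≤ ℓ := by linarith
  have hℓ0 : 0 < ℓ := by linarith
  rw [log_sliver_ratio hℓ0] at hN
  obtain ⟨hL1ge, -⟩ := rpow11_ge hℓ1
  have hL13 : (ℓ ^ (11 / 10 : ℝ)) ^ 3 ≤ ℓ ^ 4 := rpow11_pow_le hℓ1 (b := 3) (by norm_num)
  set L₁ := ℓ ^ (11 / 10 : ℝ) with hL₁
  clear_value L₁
  have h9 : 0 < ℓ ^ 9 := by positivity
  have h3 : 0 < ℓ ^ 3 := by positivity
  have e1 : 2 * L₁ / ℓ ^ 9 * ℓ ^ 9 = 2 * L₁ := div_mul_cancel₀ _ h9.ne'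
  rw [e1] at hN
  have hKN0 : 0 ≤ KN := by
    have h := (le_div_iff₀ h3).mp (hdN0.trans hdN)
    simpa using h
  have hK0 : 0 ≤ K := hK00.trans hK
  -- `L′K₀ + dN ≤ (4e^{9/2}K + K_N)·ℓ²`
  have hin : L' * K₀ + dN ≤ (4 * Real.exp (9 / 2) * K + KN) * ℓ ^ 2 := by
    have h1 : L' * K₀ ≤ 4 * Real.exp (9 / 2) * ℓ ^ 2 * K := mul_le_mul hL' hK hK00 (by positivity)
    have h2 : dN ≤ KN * ℓ ^ 2 := by
      refine hdN.trans ?_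
      rw [div_le_iff₀ h3]
      have : KN * ℓ ^ 2 * ℓ ^ 3 = KN * ℓ ^ 5 := by ring
      rw [this]
      have : (1:ℝ) ≤ ℓ ^ 5 := one_le_pow₀ hℓ1
      nlinarith
    nlinarith
  have hin0 : 0 ≤ L' * K₀ + dN := by positivity
  -- collect
  have e2 : ℓ ^ 9 / π * (2 * Real.exp 430 *
        ((B₁ * (2 * L₁ / ℓ ^ 9) * (1 + 2 * L₁)) * ((ℓ ^ 9)⁻¹ * (L' * K₀ + dN))) * (1 + 2 * L₁))
      = 4 * Real.exp 430 / π * B₁ * (L₁ * (1 + 2 * L₁) ^ 2 * (L' * K₀ + dN)) / ℓ ^ 9 := by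
    field_simp
    ring
  have h12 : (1 + 2 * L₁) ≤ 3 * L₁ := by linarith
  have hL0 : 0 ≤ L₁ := by linarith
  have hpow : L₁ * (1 + 2 * L₁) ^ 2 * (L' * K₀ + dN) ≤ 9 * ℓ ^ 4 * ((4 * Real.exp (9 / 2) * K + KN) * ℓ ^ 2) := by
    calc L₁ * (1 + 2 * L₁) ^ 2 * (L' * K₀ + dN) ≤ L₁ * (3 * L₁) ^ 2 * ((4 * Real.exp (9 / 2) * K + KN) * ℓ ^ 2) := by
          gcongr
      _ = 9 * L₁ ^ 3 * ((4 * Real.exp (9 / 2) * K + KN) * ℓ ^ 2) := by ring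
      _ ≤ 9 * ℓ ^ 4 * ((4 * Real.exp (9 / 2) * K + KN) * ℓ ^ 2) := by gcongr
  calc ℓ ^ 9 / π * N ≤ ℓ ^ 9 / π * (2 * Real.exp 430 *
        ((B₁ * (2 * L₁ / ℓ ^ 9) * (1 + 2 * L₁)) * ((ℓ ^ 9)⁻¹ * (L' * K₀ + dN))) * (1 + 2 * L₁)) :=
        mul_le_mul_of_nonneg_left hN (by positivity)
    _ = 4 * Real.exp 430 / π * B₁ * (L₁ * (1 + 2 * L₁) ^ 2 * (L' * K₀ + dN)) / ℓ ^ 9 := e2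
    _ ≤ 4 * Real.exp 430 / π * B₁ * (9 * ℓ ^ 4 * ((4 * Real.exp (9 / 2) * K + KN) * ℓ ^ 2)) / ℓ ^ 9 := by
        gcongr
    _ = 36 * Real.exp 430 / π * B₁ * (4 * Real.exp (9 / 2) * K + KN) / ℓ ^ 3 := by
        field_simp
        ring
    _ ≤ 36 * Real.exp 430 / π * B₁ * (4 * Real.exp (9 / 2) * K + KN) / ℓ := by
        apply div_le_div_of_nonneg_left (by positivity) hℓ0
        calc ℓ = ℓ ^ 1 := (pow_one ℓ).symm
          _ ≤ ℓ ^ 3 := pow_le_pow_right₀ hℓ1 (by norm_num)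

/-- **Mixed sliver, `θ_v < θ_u`, total `≤ K·𝓛⁻¹` after `×Λ/π`:** if
`N ≤ 2e⁴³⁰·[(Λ⁻¹(L′J₀ + dM))·(B₁τ₁·Ξ₀(1+2L₁)³)]·(1 + log(e^{θΛ}/e^{(θ−τ₁)Λ}))` with `0 ≤ J₀ ≤ J`, `0 ≤ dM ≤ K_M/ℓ⁵`,
`0 ≤ L′ ≤ 4e^{9/2}ℓ²`, `B₁, Ξ₀ ≥ 0`, `ℓ ≥ 3`, then `(ℓ⁹/π)·N ≤ (324e⁴³⁰/π)·B₁Ξ₀·(4e^{9/2}J + K_M)/ℓ`.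
[cite: Zhang2022LandauSiegel, §8 Lemma 8.2, p.47] -/
theorem sliverPairC_total_le {ℓ θ B₁ Ξ₀ J₀ J dM KM L' N : ℝ} (hℓ : 3 ≤ ℓ) (hB1 : 0 ≤ B₁) (hΞ0 : 0 ≤ Ξ₀)
    (hJ00 : 0 ≤ J₀) (hJ : J₀ ≤ J) (hdM0 : 0 ≤ dM) (hdM : dM ≤ KM / ℓ ^ 5) (hL'0 : 0 ≤ L')
    (hL' : L' ≤ 4 * Real.exp (9 / 2) * ℓ ^ 2)
    (hN : N ≤ 2 * Real.exp 430 *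
        (((ℓ ^ 9)⁻¹ * (L' * J₀ + dM))
          * (B₁ * (2 * ℓ ^ (11 / 10 : ℝ) / ℓ ^ 9) * (Ξ₀ * (1 + 2 * ℓ ^ (11 / 10 : ℝ)) ^ 3)))
        * (1 + Real.log (Real.exp (θ * ℓ ^ 9) / Real.exp ((θ - 2 * ℓ ^ (11 / 10 : ℝ) / ℓ ^ 9) * ℓ ^ 9)))) :
    ℓ ^ 9 / π * N ≤ 324 * Real.exp 430 / π * B₁ * Ξ₀ * (4 * Real.exp (9 / 2) * J + KM) / ℓ := by
  have hℓ1 : 1 ≤ ℓ := by linarith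
  have hℓ0 : 0 < ℓ := by linarith
  rw [log_sliver_ratio hℓ0] at hN
  obtain ⟨hL1ge, -⟩ := rpow11_ge hℓ1
  have hL15 : (ℓ ^ (11 / 10 : ℝ)) ^ 5 ≤ ℓ ^ 6 := rpow11_pow_le hℓ1 (b := 5) (by norm_num)
  set L₁ := ℓ ^ (11 / 10 : ℝ) with hL₁
  clear_value L₁
  have h9 : 0 < ℓ ^ 9 := by positivity
  have h5 : 0 < ℓ ^ 5 := by positivity
  have hKM0 : 0 ≤ KM := by
    have h := (le_div_iff₀ h5).mp (hdM0.trans hdM)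
    simpa using h
  have hJ0 : 0 ≤ J := hJ00.trans hJ
  -- `L′J₀ + dM ≤ (4e^{9/2}J + K_M)·ℓ²`
  have hin : L' * J₀ + dM ≤ (4 * Real.exp (9 / 2) * J + KM) * ℓ ^ 2 := by
    have h1 : L' * J₀ ≤ 4 * Real.exp (9 / 2) * ℓ ^ 2 * J := mul_le_mul hL' hJ hJ00 (by positivity)
    have h2 : dM ≤ KM * ℓ ^ 2 := by
      refine hdM.trans ?_
      rw [div_le_iff₀ h5]
      have : KM * ℓ ^ 2 * ℓ ^ 5 = KM * ℓ ^ 7 := by ring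
      rw [this]
      have : (1:ℝ) ≤ ℓ ^ 7 := one_le_pow₀ hℓ1
      nlinarith
    nlinarith
  have hin0 : 0 ≤ L' * J₀ + dM := by positivity
  have e2 : ℓ ^ 9 / π * (2 * Real.exp 430 *
        (((ℓ ^ 9)⁻¹ * (L' * J₀ + dM)) * (B₁ * (2 * L₁ / ℓ ^ 9) * (Ξ₀ * (1 + 2 * L₁) ^ 3))) * (1 + 2 * L₁))
      = 4 * Real.exp 430 / π * B₁ * Ξ₀ * (L₁ * (1 + 2 * L₁) ^ 4 * (L' * J₀ + dM)) / ℓ ^ 9 := by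
    field_simp
    ring
  have h12 : (1 + 2 * L₁) ≤ 3 * L₁ := by linarith
  have hL0 : 0 ≤ L₁ := by linarith
  have hpow : L₁ * (1 + 2 * L₁) ^ 4 * (L' * J₀ + dM) ≤ 81 * ℓ ^ 6 * ((4 * Real.exp (9 / 2) * J + KM) * ℓ ^ 2) := by
    calc L₁ * (1 + 2 * L₁) ^ 4 * (L' * J₀ + dM) ≤ L₁ * (3 * L₁) ^ 4 * ((4 * Real.exp (9 / 2) * J + KM) * ℓ ^ 2) := by
          gcongr
      _ = 81 * L₁ ^ 5 * ((4 * Real.exp (9 / 2) * J + KM) * ℓ ^ 2) := by ring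
      _ ≤ 81 * ℓ ^ 6 * ((4 * Real.exp (9 / 2) * J + KM) * ℓ ^ 2) := by gcongr
  calc ℓ ^ 9 / π * N ≤ ℓ ^ 9 / π * (2 * Real.exp 430 *
        (((ℓ ^ 9)⁻¹ * (L' * J₀ + dM)) * (B₁ * (2 * L₁ / ℓ ^ 9) * (Ξ₀ * (1 + 2 * L₁) ^ 3))) * (1 + 2 * L₁)) :=
        mul_le_mul_of_nonneg_left hN (by positivity)
    _ = 4 * Real.exp 430 / π * B₁ * Ξ₀ * (L₁ * (1 + 2 * L₁) ^ 4 * (L' * J₀ + dM)) / ℓ ^ 9 := e2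
    _ ≤ 4 * Real.exp 430 / π * B₁ * Ξ₀ * (81 * ℓ ^ 6 * ((4 * Real.exp (9 / 2) * J + KM) * ℓ ^ 2)) / ℓ ^ 9 := by
        gcongr
    _ = 324 * Real.exp 430 / π * B₁ * Ξ₀ * (4 * Real.exp (9 / 2) * J + KM) / ℓ := by
        field_simp
        ring

/-- **The gap scale:** for `g > 0`, `ℓ ≥ 1` and `2/g ≤ ℓ`: `2L₁/ℓ⁹ ≤ g` and `L₁/ℓ⁹ ≤ g` (`L₁ = ℓ^{1.1} ≤ ℓ²`, so
`2L₁/ℓ⁹ ≤ 2/ℓ⁷ ≤ 2/ℓ ≤ g`). [cite: Zhang2022LandauSiegel, §6 p.12] -/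
theorem gap_scales {ℓ g : ℝ} (hℓ : 1 ≤ ℓ) (hg : 0 < g) (hgℓ : 2 / g ≤ ℓ) :
    2 * ℓ ^ (11 / 10 : ℝ) / ℓ ^ 9 ≤ g ∧ ℓ ^ (11 / 10 : ℝ) / ℓ ^ 9 ≤ g := by
  have hℓ0 : 0 < ℓ := by linarith
  have hL11 : ℓ ^ (11 / 10 : ℝ) ≤ ℓ ^ 2 := by simpa using rpow11_pow_le hℓ (b := 1) (by norm_num)
  have hL0 : 0 ≤ ℓ ^ (11 / 10 : ℝ) := by positivity
  have h9 : 0 < ℓ ^ 9 := by positivity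
  have h2g : 2 ≤ ℓ * g := by rwa [div_le_iff₀ hg] at hgℓ
  have h27 : ℓ ^ 2 * ℓ ≤ ℓ ^ 9 := by
    calc ℓ ^ 2 * ℓ = ℓ ^ 3 := by ring
      _ ≤ ℓ ^ 9 := pow_le_pow_right₀ hℓ (by norm_num)
  have h1 : 2 * ℓ ^ (11 / 10 : ℝ) / ℓ ^ 9 ≤ g := by
    rw [div_le_iff₀ h9]
    nlinarith
  refine ⟨h1, ?_⟩
  have : ℓ ^ (11 / 10 : ℝ) / ℓ ^ 9 ≤ 2 * ℓ ^ (11 / 10 : ℝ) / ℓ ^ 9 := by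
    rw [div_le_div_iff_of_pos_right h9]; linarith
  exact this.trans h1

end Literature.NumberTheory.LFunctions.Zhang2022.DipoleRule

end
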